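import Literature.AlgebraicGeometry.HodgeTheory.AbelianVarietyAnalyticH0SqEqCardKTheta
import Literature.AlgebraicGeometry.HodgeTheory.GAGASectionsOfLineBundle
import HarnessLib

/-!
# `h⁰(A, 𝒪_A(Θ))² = #K(Θ)` for an ample divisor on a complex abelian variety
# (Mumford, *Abelian Varieties*, §16: the Riemann–Roch theorem `χ(L)² = deg φ_L` with the vanishing theorem `χ(L) = h⁰(L)`)

Layer `Literature/AlgebraicGeometry/HodgeTheory`, namespace `Literature.AlgebraicGeometry.Motives.AbelianVariety`.  THEOREMS ONLY (no definition,
no named fact, no instance, no `sorry`).  The RANK brick (R2) of the cell's F-2 (b) field case (census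
`B-provers/B-p05/g17/CENSUS-F2b-Rank.B-p05g17.md`, road (a) of record, B-plan1 (g16) 2026-08-30T07:48:31Z), assembled from

* ★ (R1) `HodgeTheory/GAGASectionsOfLineBundle` (B-p18 (g18)): GAGA for `H⁰` — `dim_ℂ Γ(A, 𝒪_A(Θ)) = h⁰(𝒪_A(Θ)^an)`
  (`AbelianVariety.finrank_sections_eq_finrank_sectionSpace`, [SerreGAGA1956] n° 12 Théorème 1);
* ★ (R2-an) `HodgeTheory/AbelianVarietyAnalyticH0SqEqCardKTheta`: `h⁰(𝒪_A(Θ)^an)² = #K(Θ)(ℂ)` for `Θ` ample (Appell–Humbert, positivity of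
  ample bundles, Lange Cor. 1.7.2 `#K(L) = h⁰(L)²`);
* ★ the torus uniformisation of a complex abelian variety (`complexAbelianVariety_torusUniformised_holds`).

Results (for `A` an abelian variety over `ℂ`, `Θ` an AMPLE Cartier divisor on `A`, `K(Θ) = {x ∈ A(ℂ) ; t_x^*Θ ∼ Θ}` ★ `AbelianVariety.KTheta`):
* `finrank_sections_sq_eq_natCard_KTheta_of_uniformisation` — with a given uniformisation;
* **`finrank_sections_sq_eq_natCard_KTheta`** — **`(dim_ℂ Γ(A, 𝒪_A(Θ)))² = #K(Θ)`**, uniformisation-free;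
* `h0_sq_eq_natCard_KTheta` — the same with ★ `CartierDivisor.h0`.

With ★ `natCard_kOfL_eq_polarizationDegree_sq` / ★ `Polarization.natCard_kerPointsAt_eq_of_hasType` (kernel counts) this is the number
`h⁰(A_s̄, L^Δ(λ)_s̄^{⊗3}) = 6^g ∏δᵢ` over `ℂ`; the transport `ℂ ⇝ Ω` to every algebraically closed field of characteristic `0` is R3.
Count-neutral; HC_CM is proved only modulo the 7 printed citations until rung 0 closes — nothing here refers to it.

## References
* [MumfordAV1970] D. Mumford, *Abelian Varieties*, TIFR Studies in Mathematics 5 (1970), §16 (the Riemann–Roch theorem; the vanishing theorem).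
* [SerreGAGA1956] J.-P. Serre, *Géométrie algébrique et géométrie analytique*, Ann. Inst. Fourier 6 (1956), n° 12 Théorème 1 (p. 19).
* [Lange2023AbelianVarietiesComplex] H. Lange, *Abelian Varieties over the Complex Numbers* (2023), §1.7.1 Cor. 1.7.2, §2.1.3 Prop. 2.1.11 (p. 80).
-/

noncomputable section

open Set Function CategoryTheory AlgebraicGeometry
open scoped Manifold ContDiff Topology
open Literature.AlgebraicGeometry.Motives Literature.Geometry.Kaehler Literature.Geometry.Kaehler.ComplexTorus
open Literature.NumberTheory.Transcendental Literature.AlgebraicGeometry.HodgeTheory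

namespace Literature.AlgebraicGeometry.Motives.AbelianVariety

/-- **`(dim_ℂ Γ(A, 𝒪_A(Θ)))² = #K(Θ)(ℂ)` for `Θ` ample**, with respect to a given torus uniformisation `φ : V/Λ → A(ℂ)` compatible with the
group laws: GAGA for `H⁰` (★ R1) followed by the analytic identity (★ R2-an). [cite: MumfordAV1970, §16 (the Riemann–Roch theorem)]
[cite: SerreGAGA1956, n° 12 Théorème 1 (p. 19)] -/
theorem finrank_sections_sq_eq_natCard_KTheta_of_uniformisation (A : AbelianVariety ℂ) {ι : Type} [Fintype ι] [DecidableEq ι]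
    {Φ : (ι → ℝ) ≃L[ℝ] (Fin A.dim → ℂ)} {φ : ComplexTorus Φ → ComplexPoints A.X}
    (hφ : IsAnalytification (Fin A.dim → ℂ) A.X A.dim φ) (hadd : ∀ x y, φ (x + y) = φ x * φ y)
    (Θ : CartierDivisor A.X.left) (hΘ : Θ.IsAmple) :
    Module.finrank ℂ (Θ.sections ℂ) ^ 2 = Nat.card (A.KTheta Θ) := by
  rw [A.finrank_sections_eq_finrank_sectionSpace Φ hφ Θ]
  exact A.finrank_sectionSpace_cartierDivisorLineBundle_sq_eq_natCard_KTheta hφ hadd Θ hΘ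

/-- **`(dim_ℂ Γ(A, 𝒪_A(Θ)))² = #K(Θ)(ℂ)` for an ample divisor `Θ` on a complex abelian variety** ([MumfordAV1970] §16: Riemann–Roch
`χ(𝒪(Θ))² = deg φ_Θ = #K(Θ)` and the vanishing theorem `χ = h⁰` for ample `Θ`; here via the analytic theory of theta functions on the uniformising
torus — ★ `complexAbelianVariety_torusUniformised_holds` — and GAGA). [cite: MumfordAV1970, §16 (the Riemann–Roch theorem)]
[cite: SerreGAGA1956, n° 12 Théorème 1 (p. 19)] -/
theorem finrank_sections_sq_eq_natCard_KTheta (A : AbelianVariety ℂ) (Θ : CartierDivisor A.X.left) (hΘ : Θ.IsAmple) :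
    Module.finrank ℂ (Θ.sections ℂ) ^ 2 = Nat.card (A.KTheta Θ) := by
  obtain ⟨ι, _, _, Φ, φ, hφ, hadd⟩ := complexAbelianVariety_torusUniformised_holds A
  exact A.finrank_sections_sq_eq_natCard_KTheta_of_uniformisation hφ hadd Θ hΘ

/-- **`h⁰(A, 𝒪_A(Θ))² = #K(Θ)(ℂ)`** for an ample divisor on a complex abelian variety, in the ★ `CartierDivisor.h0` spelling.
[cite: MumfordAV1970, §16 (the Riemann–Roch theorem)] [cite: SerreGAGA1956, n° 12 Théorème 1 (p. 19)] -/
theorem h0_sq_eq_natCard_KTheta (A : AbelianVariety ℂ) (Θ : CartierDivisor A.X.left) (hΘ : Θ.IsAmple) :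
    Θ.h0 ℂ ^ 2 = Nat.card (A.KTheta Θ) :=
  A.finrank_sections_sq_eq_natCard_KTheta Θ hΘ

end Literature.AlgebraicGeometry.Motives.AbelianVariety

end
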